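import Mathlib
import HarnessLib
import Summits.HubbardSuperconductivity.HubbardSuperconductivity.Theorems.KLProgrammeKLRegimeWickScaleFlowLadderStep
import Summits.HubbardSuperconductivity.HubbardSuperconductivity.Theorems.KLProgrammeKLRegimeEnginePairLadderDuhamelConjugated

/-!
# Route `KLProgramme` — crux K3, ENGINE child gen 6 (stmt-HubbardSuperconductivity-20236 `KLRegimeEngineV16`), stub `stub_engine_step_values`,
# conjunct (E2-v10) at `1 ≤ n`: the end-to-end composition on the continuous organisation with DRESSED rungs and CONJUGATED leg dressing —
# `pairLadderStepAtV10_of_scaleFlow_dressed`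

Cell gate-hubbard-kl, seat hubbard-kl-k3c1-p1 (g7), technique «composed-map remainder propagation».  `pairLadderStepAtV10_of_scaleFlow`
(`…WickScaleFlowLadderStep`, p519462) fixes the Riccati rungs to the BARE soft-pair product and puts everything else in the source `X`.  FINDING
(p1 g10 E2-SIGMA-DRESSING.md + k3c1-p1 KL STATUS 2026-08-27T10:2xZ): the self-energy dressing of the rungs (S62's pp arrangement; the one-line
leg term at internal indices) is then charged `n`-uniformly to the budget, which has no such token — it must live in the weight.  This file is the
organisation-agnostic door: the rung RATE `ḃ` and the diagonal leg dressings `α, γ` are FREE (the taker chooses dressed rungs and conjugates the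
linear leg term away, `kltc_wickStep_of_flow_conjugated`), the source is BY DEFINITION `X = Γ̇ + Γ·diag ḃ·Γ + diag α̇·Γ + Γ·diag γ̇`
(`klws_flow_source_eq` is its bare instance), and the flow data of the model's real-cutoff pair kernel are still discharged here.

* §1 **`klws_wickArrayStep_of_scaleFlow_dressed`** — (W-a)_n for `klWickPairArray … (n−1)/n Qm` with the DRESSED step weight
  `W(z) = ∫₀¹ ḃ_t(z)e^{−α_t(z)−γ_t(z)}dt` (aggregated over frequencies to a real `w₁`): `∃ N` two-sided inverse of `1 + diag w₁·X₀`,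
  `‖W‖ ≤ e^{2A}ρ`, and `‖Y(k,k′) − (X₀N)(k,k′)‖ ≤ e^{‖α₁‖+‖γ₁‖}·FT_{e^{2A}ρ, e^{2A}m_W}(IX) + (e^{‖α₁‖+‖γ₁‖} − 1)(3/2)m_W + [localisation]` at the
  external entries;
* §2 **`pairLadderStepAtV10_of_scaleFlow_dressed`** — §1 per pair class + forward straddles + majorants + masses + V10 budget
  (`pairLadderStepAtV10_of_wickTower_fwd`) ⟹ `PairLadderStepAtV10 L M G P Q β U μ K n`.

Exact calculus and algebra over the landed files; every size is a hypothesis; nothing about superconductivity is asserted.  0 kit.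
-/

noncomputable section

namespace Summit.HubbardSuperconductivity.HubbardSuperconductivity.Theorems.KLRegimeWick

set_option linter.dupNamespace false -- summit = problem name (single-conjunct summit), D-0017

open Set Finset Matrix Literature.MathematicalPhysics.QuantumLattice GrassmannAlgebra
open Literature.Probability.LatticeModels
open Summit.HubbardSuperconductivity.HubbardSuperconductivity.Theorems.TwoPointAssembly
open Summit.HubbardSuperconductivity.HubbardSuperconductivity.Theorems.KLProgrammeLegKernels
open Summit.HubbardSuperconductivity.HubbardSuperconductivity.Theorems.KLRegimeSplit
open scoped Topology

section Model

variable (L M : ℕ) [NeZero L] [NeZero M] (β U μ : ℝ) (K : TrigPolyC4v)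

/-! ## §1 The Wick step with dressed rungs and conjugated leg dressing -/

/-- **(W-a)_n for the model's ball-truncated Wick pair arrays, dressed rungs, conjugated leg dressing** (grid slice `[Λ_n, Λ_{n−1}]`).
Model inputs: `Z^K ≠ 0` on the slice; `Γ, Γ̇` the real-cutoff pair kernel and its derivative along the affine path (pass `rfl, rfl`).  Taker's
choices: the rung rate `ḃ` (continuous), the diagonal dressings `α, γ` (C¹, `α 0 = γ 0 = 0`, `‖α‖,‖γ‖ ≤ A`), whence the source
`X_t := Γ̇_t + Γ_t·diag ḃ_t·Γ_t + diag α̇_t·Γ_t + Γ_t·diag γ̇_t` and the dressed step weight `W(z) := ∫₀¹ ḃ_t(z)e^{−α_t(z)−γ_t(z)}dt` (pass `rfl`);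
a real `w₁` with `Σ_ν W(k,ν) = w₁ k`; an a priori bound `m_W` of `Γ` along the slice; integral tails `∫_t^1‖ḃ_s(z)‖ds ≤ ρ_z`; smallness
`(3/2)(e^{2A}m_W)(Σ e^{2A}ρ) ≤ 1/3`; a majorant `IX(x,y) ≥ ∫₀¹‖e^{α_t(x)}X_t(x,y)e^{γ_t(y)}‖dt`.  THEN with `X₀ := klWickPairArray … (n−1) Q`,
`Y := klWickPairArray … n Q`, `K := klWickPairKernel … (n−1) Q`, `ρ̃ := e^{2A}ρ`, `m̃ := e^{2A}m_W`: `∃ N`, `(1 + diag w₁·X₀)N = 1 = N(1 + diag w₁·X₀)`,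
`‖W‖ ≤ ρ̃`, and on `klBall²`
`‖Y(k,k′) − (X₀N)(k,k′)‖ ≤ e^{‖α₁(k,ω₀)‖+‖γ₁(k′,ω₀)‖}·[IX + (3/2)(3/2 m̃)Σ_c IX(·,c)ρ̃_c + (3/2)m̃Σ_a ρ̃_a IX(a,·) + (9/4)m̃(3/2 m̃)ΣΣ ρ̃ IX ρ̃]((k,ω₀),(k′,ω₀))
 + (e^{‖α₁(k,ω₀)‖+‖γ₁(k′,ω₀)‖} − 1)(3/2)m_W + (3/2)m_W Σ_c‖K((k,ω₀),c) − X₀(k,c.1)‖‖W_c‖ + (3/2)m_W Σ_a‖W_a‖‖K(a,(k′,ω₀)) − X₀(a.1,k′)‖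
 + (9/4)m_W² ΣΣ‖W_a‖‖K(a,c) − X₀(a.1,c.1)‖‖W_c‖`. -/
theorem klws_wickArrayStep_of_scaleFlow_dressed (n : ℕ)
    (hZ : ∀ Λ ∈ Icc (klScale klE0 n) (klScale klE0 (n - 1)), hubbardEffPartitionFnCT L M β U μ 0 K Λ ≠ 0) (Q : TorusSite 2 L)
    (Γ Γ' Xs : ℝ → Matrix (TorusSite 2 L × MatsubaraIdx M) (TorusSite 2 L × MatsubaraIdx M) ℂ)
    (b' α αd γ γd : ℝ → TorusSite 2 L × MatsubaraIdx M → ℂ) (W : TorusSite 2 L × MatsubaraIdx M → ℂ)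
    (hΓdef : Γ = fun t => Matrix.of fun x y => vertexFn L M β
      (gaussConv ℂ (hubbardCovBelowCT L M β μ 0 K (klScale klE0 (n - 1) + t * (klScale klE0 n - klScale klE0 (n - 1))))
        (hubbardEffectiveActionCT L M β U μ 0 K (klScale klE0 (n - 1) + t * (klScale klE0 n - klScale klE0 (n - 1))))) 4
      ![(((y.2, y.1), 0), 0), (((y.2.rev, Q - y.1), 1), 0), (((x.2.rev, Q - x.1), 1), 1), (((x.2, x.1), 0), 1)])
    (hΓ'def : Γ' = fun t => Matrix.of fun x y => (klScale klE0 n - klScale klE0 (n - 1)) • -((2 : ℂ)⁻¹ * vertexFn L M β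
      (gaussConv ℂ (hubbardCovBelowCT L M β μ 0 K (klScale klE0 (n - 1) + t * (klScale klE0 n - klScale klE0 (n - 1))))
        (grassmannDerivPairing ℂ
          (Matrix.of fun X Y : HubbardFieldIdx L M =>
            deriv (fun Λ'' : ℝ => hubbardCovAboveCT L M β μ 0 K Λ'' X Y)
              (klScale klE0 (n - 1) + t * (klScale klE0 n - klScale klE0 (n - 1))))
          (hubbardEffectiveActionCT L M β U μ 0 K (klScale klE0 (n - 1) + t * (klScale klE0 n - klScale klE0 (n - 1))))
          (hubbardEffectiveActionCT L M β U μ 0 K (klScale klE0 (n - 1) + t * (klScale klE0 n - klScale klE0 (n - 1)))))) 4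
      ![(((y.2, y.1), 0), 0), (((y.2.rev, Q - y.1), 1), 0), (((x.2.rev, Q - x.1), 1), 1), (((x.2, x.1), 0), 1)]))
    (hXs : ∀ t ∈ Icc (0 : ℝ) 1, Xs t = Γ' t + Γ t * diagonal (b' t) * Γ t + diagonal (αd t) * Γ t + Γ t * diagonal (γd t))
    (hW : W = fun a => ∫ s in (0 : ℝ)..1, b' s a * Complex.exp (-(α s a + γ s a)))
    (w₁ : TorusSite 2 L → ℝ) (hw₁ : ∀ s, ∑ c : MatsubaraIdx M, W (s, c) = (w₁ s : ℂ))
    (ρ : TorusSite 2 L × MatsubaraIdx M → ℝ) {mW A : ℝ} (hmW : 0 ≤ mW) (hA : 0 ≤ A)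
    (hb'c : ∀ a, ContinuousOn (fun t => b' t a) (Icc 0 1))
    (hα : ∀ t ∈ Icc (0 : ℝ) 1, ∀ x, HasDerivAt (fun s => α s x) (αd t x) t)
    (hαdc : ∀ x, ContinuousOn (fun t => αd t x) (Icc 0 1))
    (hγ : ∀ t ∈ Icc (0 : ℝ) 1, ∀ x, HasDerivAt (fun s => γ s x) (γd t x) t)
    (hγdc : ∀ x, ContinuousOn (fun t => γd t x) (Icc 0 1))
    (hα0 : α 0 = 0) (hγ0 : γ 0 = 0)
    (hΓm : ∀ t ∈ Icc (0 : ℝ) 1, ∀ x y, ‖Γ t x y‖ ≤ mW)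
    (hαA : ∀ t ∈ Icc (0 : ℝ) 1, ∀ x, ‖α t x‖ ≤ A) (hγA : ∀ t ∈ Icc (0 : ℝ) 1, ∀ x, ‖γ t x‖ ≤ A)
    (hρ : ∀ t ∈ Icc (0 : ℝ) 1, ∀ a, ∫ s in t..1, ‖b' s a‖ ≤ ρ a)
    (hsm : 3 / 2 * (Real.exp (2 * A) * mW) * ∑ a, Real.exp (2 * A) * ρ a ≤ 1 / 3)
    (IX : TorusSite 2 L × MatsubaraIdx M → TorusSite 2 L × MatsubaraIdx M → ℝ)
    (hIX : ∀ x y, (∫ t in (0 : ℝ)..1, ‖Complex.exp (α t x) * Xs t x y * Complex.exp (γ t y)‖) ≤ IX x y) :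
    ∃ N : Matrix (TorusSite 2 L) (TorusSite 2 L) ℂ,
      (1 + diagonal (fun p => (w₁ p : ℂ)) * klWickPairArray L M β U μ K (n - 1) Q) * N = 1 ∧
      N * (1 + diagonal (fun p => (w₁ p : ℂ)) * klWickPairArray L M β U μ K (n - 1) Q) = 1 ∧
      (∀ a, ‖W a‖ ≤ Real.exp (2 * A) * ρ a) ∧
      ∀ k ∈ klBall L μ K, ∀ k' ∈ klBall L μ K,
        ‖klWickPairArray L M β U μ K n Q k k' - (klWickPairArray L M β U μ K (n - 1) Q * N) k k'‖ ≤
          (Real.exp (‖α 1 (k, omega0 M)‖ + ‖γ 1 (k', omega0 M)‖) *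
              (IX (k, omega0 M) (k', omega0 M) +
                3 / 2 * (3 / 2 * (Real.exp (2 * A) * mW)) * ∑ c, IX (k, omega0 M) c * (Real.exp (2 * A) * ρ c) +
                3 / 2 * (Real.exp (2 * A) * mW) * ∑ a, (Real.exp (2 * A) * ρ a) * IX a (k', omega0 M) +
                9 / 4 * (Real.exp (2 * A) * mW) * (3 / 2 * (Real.exp (2 * A) * mW)) *
                  ∑ a, ∑ c, (Real.exp (2 * A) * ρ a) * IX a c * (Real.exp (2 * A) * ρ c)) +
            (Real.exp (‖α 1 (k, omega0 M)‖ + ‖γ 1 (k', omega0 M)‖) - 1) * (3 / 2 * mW)) +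
          (3 / 2 * mW * ∑ c, ‖klWickPairKernel L M β U μ K (n - 1) Q (k, omega0 M) c -
              klWickPairArray L M β U μ K (n - 1) Q k c.1‖ * ‖W c‖ +
            3 / 2 * mW * ∑ a, ‖W a‖ * ‖klWickPairKernel L M β U μ K (n - 1) Q a (k', omega0 M) -
              klWickPairArray L M β U μ K (n - 1) Q a.1 k'‖ +
            9 / 4 * mW * mW * ∑ a, ∑ c, ‖W a‖ * ‖klWickPairKernel L M β U μ K (n - 1) Q a c -
              klWickPairArray L M β U μ K (n - 1) Q a.1 c.1‖ * ‖W c‖) := by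
  obtain ⟨hpos, hle⟩ := klws_klScale_pos_antitone n
  -- (1) flow data of the model
  obtain ⟨hΓ, hΓ'c⟩ := klws_pairKernelR_flowData L M β U μ K hle hpos hZ Q Γ Γ' hΓdef hΓ'def
  -- (2) the rate is bounded along the compact path
  obtain ⟨βr, hβr⟩ : ∃ βr : ℝ, ∀ t ∈ Icc (0 : ℝ) 1, ∑ a, ‖b' t a‖ ≤ βr := by
    have hcont : ContinuousOn (fun t => ∑ a, ‖b' t a‖) (Icc (0 : ℝ) 1) :=
      continuousOn_finsetSum _ fun a _ => (hb'c a).norm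
    obtain ⟨βr, hβr⟩ := isCompact_Icc.bddAbove_image hcont
    exact ⟨βr, fun t ht => hβr ⟨t, ht, rfl⟩⟩
  -- (3) the base array `X₀` is bounded by the a priori bound at `t = 0`
  have h0 : ∀ a c : TorusSite 2 L × MatsubaraIdx M, Γ 0 a c = klWickPairKernel L M β U μ K (n - 1) Q a c := fun a c => by
    subst hΓdef
    simp only [Matrix.of_apply, zero_mul, add_zero]
    exact klws_pairKernelR_klScale L M β U μ K (n - 1) Q a c
  have hC : ∀ s t, ‖klWickPairArray L M β U μ K (n - 1) Q s t‖ ≤ mW := by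
    intro s t
    by_cases hst : s ∈ klBall L μ K ∧ t ∈ klBall L μ K
    · rw [klws_wickPairArray_eq_kernel_on L M β U μ K (n - 1) Q hst.1 hst.2, ← h0]
      exact hΓm 0 ⟨le_rfl, zero_le_one⟩ _ _
    · rw [klws_wickPairArray_eq_zero_off L M β U μ K (n - 1) Q s t hst, norm_zero]; exact hmW
  -- (4) smallness for the base array
  have hρ0 : ∀ a, 0 ≤ ρ a := fun a => by
    have h := hρ 1 ⟨zero_le_one, le_rfl⟩ a
    rw [intervalIntegral.integral_same] at h
    exact h
  have heA1 : 1 ≤ Real.exp (2 * A) := Real.one_le_exp (by positivity)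
  have hZ0 : 0 ≤ ∑ a, Real.exp (2 * A) * ρ a := sum_nonneg fun a _ => mul_nonneg (Real.exp_pos _).le (hρ0 a)
  have hsm₀ : mW * ∑ a, Real.exp (2 * A) * ρ a ≤ 1 / 3 := by
    have h1 : mW ≤ 3 / 2 * (Real.exp (2 * A) * mW) := by nlinarith
    exact (mul_le_mul_of_nonneg_right h1 hZ0).trans hsm
  -- (5) the conjugated Duhamel step on the grid slice
  obtain ⟨N, hN1, hN2, -, hWρ, hstep⟩ := kltc_wickStep_of_flow_conjugated (klWickPairArray L M β U μ K (n - 1) Q) Γ Γ' Xs b' α αd γ γd ρ W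
    hmW hmW hA hC hΓ hΓ'c hb'c hα hαdc hγ hγdc hα0 hγ0 hXs hΓm hαA hγA hβr hρ hsm hsm₀ hW
  -- (6) the aggregated weight is the real `w₁`
  have hdiag : (fun s => ∑ c : MatsubaraIdx M, W (s, c)) = fun p => (w₁ p : ℂ) := by
    funext s; exact hw₁ s
  rw [hdiag] at hN1 hN2
  refine ⟨N, hN1, hN2, hWρ, fun k hk k' hk' => ?_⟩
  have h1 : ∀ a c : TorusSite 2 L × MatsubaraIdx M, Γ 1 a c = klWickPairKernel L M β U μ K n Q a c := fun a c => by
    subst hΓdef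
    simp only [Matrix.of_apply, one_mul, add_sub_cancel]
    exact klws_pairKernelR_klScale L M β U μ K n Q a c
  have h := hstep (k, omega0 M) (k', omega0 M)
  simp only [h0, h1] at h
  rw [← klws_wickPairArray_eq_kernel_on L M β U μ K n Q hk hk',
    klws_wickPairArray_eq_kernel_on L M β U μ K (n - 1) Q hk hk', sub_self, norm_zero, zero_add] at h
  refine h.trans ?_
  -- monotonicity in the source majorant
  have hrt0 : ∀ a, 0 ≤ Real.exp (2 * A) * ρ a := fun a => mul_nonneg (Real.exp_pos _).le (hρ0 a)
  have e1 := hIX (k, omega0 M) (k', omega0 M)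
  have e2 : 3 / 2 * (3 / 2 * (Real.exp (2 * A) * mW)) *
        ∑ c, (∫ t in (0 : ℝ)..1, ‖Complex.exp (α t (k, omega0 M)) * Xs t (k, omega0 M) c * Complex.exp (γ t c)‖) *
          (Real.exp (2 * A) * ρ c) ≤
      3 / 2 * (3 / 2 * (Real.exp (2 * A) * mW)) * ∑ c, IX (k, omega0 M) c * (Real.exp (2 * A) * ρ c) :=
    mul_le_mul_of_nonneg_left (sum_le_sum fun c _ => mul_le_mul_of_nonneg_right (hIX _ _) (hrt0 c)) (by positivity)
  have e3 : 3 / 2 * (Real.exp (2 * A) * mW) *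
        ∑ a, (Real.exp (2 * A) * ρ a) * (∫ t in (0 : ℝ)..1, ‖Complex.exp (α t a) * Xs t a (k', omega0 M) * Complex.exp (γ t (k', omega0 M))‖) ≤
      3 / 2 * (Real.exp (2 * A) * mW) * ∑ a, (Real.exp (2 * A) * ρ a) * IX a (k', omega0 M) :=
    mul_le_mul_of_nonneg_left (sum_le_sum fun a _ => mul_le_mul_of_nonneg_left (hIX _ _) (hrt0 a)) (by positivity)
  have e4 : 9 / 4 * (Real.exp (2 * A) * mW) * (3 / 2 * (Real.exp (2 * A) * mW)) *
        ∑ a, ∑ c, (Real.exp (2 * A) * ρ a) *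
          (∫ t in (0 : ℝ)..1, ‖Complex.exp (α t a) * Xs t a c * Complex.exp (γ t c)‖) * (Real.exp (2 * A) * ρ c) ≤
      9 / 4 * (Real.exp (2 * A) * mW) * (3 / 2 * (Real.exp (2 * A) * mW)) *
        ∑ a, ∑ c, (Real.exp (2 * A) * ρ a) * IX a c * (Real.exp (2 * A) * ρ c) :=
    mul_le_mul_of_nonneg_left (sum_le_sum fun a _ => sum_le_sum fun c _ =>
      mul_le_mul_of_nonneg_right (mul_le_mul_of_nonneg_left (hIX _ _) (hrt0 a)) (hrt0 c)) (by positivity)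
  have hE0 : 0 ≤ Real.exp (‖α 1 (k, omega0 M)‖ + ‖γ 1 (k', omega0 M)‖) := (Real.exp_pos _).le
  have e5 := mul_le_mul_of_nonneg_left (add_le_add (add_le_add (add_le_add e1 e2) e3) e4) hE0
  linarith [e5]

/-! ## §2 The end-to-end composition with dressed rungs -/

/-- **(E2-v10) `PairLadderStepAtV10 … n` (`1 ≤ n`) on the continuous organisation, dressed rungs, conjugated leg dressing — end to end.**
As `pairLadderStepAtV10_of_scaleFlow` (p519462) with the Wick-step block replaced by `klws_wickArrayStep_of_scaleFlow_dressed`: per pair class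
the taker now CHOOSES the rung rate `ḃ` and the diagonal dressings `α, γ` (with their calculus facts and bounds), defines the source
`X := Γ̇ + Γ·diag ḃ·Γ + diag α̇·Γ + Γ·diag γ̇` and the dressed step weight `W := ∫₀¹ḃe^{−α−γ}`, and supplies the majorants; the model's flow
data are discharged here.  Global inputs: `|𝒞̂_{n−1}| ≤ m`, `Z^K ≠ 0` on `[Λ_n, Λ_{n−1}]`, and `Γ, Γ̇` as functions of the total momentum
(pass `rfl, rfl`). -/
theorem pairLadderStepAtV10_of_scaleFlow_dressed {G : GeoConsts} {P : SplitConsts} {Q : EngConsts} {n : ℕ} {m : ℝ} (hn : 1 ≤ n)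
    (hm : 0 ≤ m) (hC₀ : ∀ Qm s t, ‖klPairArray L M β U μ K (n - 1) Qm s t‖ ≤ m)
    (hZ : ∀ Λ ∈ Icc (klScale klE0 n) (klScale klE0 (n - 1)), hubbardEffPartitionFnCT L M β U μ 0 K Λ ≠ 0)
    (Γ Γ' : TorusSite 2 L → ℝ → Matrix (TorusSite 2 L × MatsubaraIdx M) (TorusSite 2 L × MatsubaraIdx M) ℂ)
    (hΓdef : Γ = fun Qm t => Matrix.of fun x y => vertexFn L M β
      (gaussConv ℂ (hubbardCovBelowCT L M β μ 0 K (klScale klE0 (n - 1) + t * (klScale klE0 n - klScale klE0 (n - 1))))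
        (hubbardEffectiveActionCT L M β U μ 0 K (klScale klE0 (n - 1) + t * (klScale klE0 n - klScale klE0 (n - 1))))) 4
      ![(((y.2, y.1), 0), 0), (((y.2.rev, Qm - y.1), 1), 0), (((x.2.rev, Qm - x.1), 1), 1), (((x.2, x.1), 0), 1)])
    (hΓ'def : Γ' = fun Qm t => Matrix.of fun x y => (klScale klE0 n - klScale klE0 (n - 1)) • -((2 : ℂ)⁻¹ * vertexFn L M β
      (gaussConv ℂ (hubbardCovBelowCT L M β μ 0 K (klScale klE0 (n - 1) + t * (klScale klE0 n - klScale klE0 (n - 1))))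
        (grassmannDerivPairing ℂ
          (Matrix.of fun X Y : HubbardFieldIdx L M =>
            deriv (fun Λ'' : ℝ => hubbardCovAboveCT L M β μ 0 K Λ'' X Y)
              (klScale klE0 (n - 1) + t * (klScale klE0 n - klScale klE0 (n - 1))))
          (hubbardEffectiveActionCT L M β U μ 0 K (klScale klE0 (n - 1) + t * (klScale klE0 n - klScale klE0 (n - 1))))
          (hubbardEffectiveActionCT L M β U μ 0 K (klScale klE0 (n - 1) + t * (klScale klE0 n - klScale klE0 (n - 1)))))) 4
      ![(((y.2, y.1), 0), 0), (((y.2.rev, Qm - y.1), 1), 0), (((x.2.rev, Qm - x.1), 1), 1), (((x.2, x.1), 0), 1)]))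
    (htower : ∀ Qm : TorusSite 2 L, IsPairClassAt L Qm n →
      ∃ (M' M₀ : Matrix (TorusSite 2 L) (TorusSite 2 L) ℂ) (bp w₁ bs : TorusSite 2 L → ℝ)
        (Xs : ℝ → Matrix (TorusSite 2 L × MatsubaraIdx M) (TorusSite 2 L × MatsubaraIdx M) ℂ)
        (b' α αd γ γd : ℝ → TorusSite 2 L × MatsubaraIdx M → ℂ) (W : TorusSite 2 L × MatsubaraIdx M → ℂ)
        (ρ : TorusSite 2 L × MatsubaraIdx M → ℝ)
        (R' Ea ER E₁ E₂ : TorusSite 2 L → TorusSite 2 L → ℝ)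
        (IX : TorusSite 2 L × MatsubaraIdx M → TorusSite 2 L × MatsubaraIdx M → ℝ) (r' eR e₁ mW A : ℝ),
        0 ≤ r' ∧ 0 ≤ eR ∧ 0 ≤ e₁ ∧ 0 ≤ mW ∧ 0 ≤ A ∧
        (∀ x y, 0 ≤ R' x y) ∧ (∀ x y, 0 ≤ Ea x y) ∧ (∀ x y, 0 ≤ ER x y) ∧
        -- the Wick step from the scale flow: the taker's split (rungs, dressings, source) and its majorants
        (∀ t ∈ Icc (0 : ℝ) 1, Xs t = Γ' Qm t + Γ Qm t * diagonal (b' t) * Γ Qm t + diagonal (αd t) * Γ Qm t + Γ Qm t * diagonal (γd t)) ∧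
        (W = fun a => ∫ s in (0 : ℝ)..1, b' s a * Complex.exp (-(α s a + γ s a))) ∧
        (∀ s, ∑ c : MatsubaraIdx M, W (s, c) = (w₁ s : ℂ)) ∧
        (∀ a, ContinuousOn (fun t => b' t a) (Icc 0 1)) ∧
        (∀ t ∈ Icc (0 : ℝ) 1, ∀ x, HasDerivAt (fun s => α s x) (αd t x) t) ∧ (∀ x, ContinuousOn (fun t => αd t x) (Icc 0 1)) ∧
        (∀ t ∈ Icc (0 : ℝ) 1, ∀ x, HasDerivAt (fun s => γ s x) (γd t x) t) ∧ (∀ x, ContinuousOn (fun t => γd t x) (Icc 0 1)) ∧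
        α 0 = 0 ∧ γ 0 = 0 ∧
        (∀ t ∈ Icc (0 : ℝ) 1, ∀ x y, ‖Γ Qm t x y‖ ≤ mW) ∧
        (∀ t ∈ Icc (0 : ℝ) 1, ∀ x, ‖α t x‖ ≤ A) ∧ (∀ t ∈ Icc (0 : ℝ) 1, ∀ x, ‖γ t x‖ ≤ A) ∧
        (∀ t ∈ Icc (0 : ℝ) 1, ∀ a, ∫ s in t..1, ‖b' s a‖ ≤ ρ a) ∧
        3 / 2 * (Real.exp (2 * A) * mW) * ∑ a, Real.exp (2 * A) * ρ a ≤ 1 / 3 ∧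
        (∀ x y, (∫ t in (0 : ℝ)..1, ‖Complex.exp (α t x) * Xs t x y * Complex.exp (γ t y)‖) ≤ IX x y) ∧
        (∀ k ∈ klBall L μ K, ∀ k' ∈ klBall L μ K,
          (Real.exp (‖α 1 (k, omega0 M)‖ + ‖γ 1 (k', omega0 M)‖) *
              (IX (k, omega0 M) (k', omega0 M) +
                3 / 2 * (3 / 2 * (Real.exp (2 * A) * mW)) * ∑ c, IX (k, omega0 M) c * (Real.exp (2 * A) * ρ c) +
                3 / 2 * (Real.exp (2 * A) * mW) * ∑ a, (Real.exp (2 * A) * ρ a) * IX a (k', omega0 M) +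
                9 / 4 * (Real.exp (2 * A) * mW) * (3 / 2 * (Real.exp (2 * A) * mW)) *
                  ∑ a, ∑ c, (Real.exp (2 * A) * ρ a) * IX a c * (Real.exp (2 * A) * ρ c)) +
            (Real.exp (‖α 1 (k, omega0 M)‖ + ‖γ 1 (k', omega0 M)‖) - 1) * (3 / 2 * mW)) +
          (3 / 2 * mW * ∑ c, ‖klWickPairKernel L M β U μ K (n - 1) Qm (k, omega0 M) c -
              klWickPairArray L M β U μ K (n - 1) Qm k c.1‖ * ‖W c‖ +
            3 / 2 * mW * ∑ a, ‖W a‖ * ‖klWickPairKernel L M β U μ K (n - 1) Qm a (k', omega0 M) -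
              klWickPairArray L M β U μ K (n - 1) Qm a.1 k'‖ +
            9 / 4 * mW * mW * ∑ a, ∑ c, ‖W a‖ * ‖klWickPairKernel L M β U μ K (n - 1) Qm a c -
              klWickPairArray L M β U μ K (n - 1) Qm a.1 c.1‖ * ‖W c‖) ≤ Ea k k') ∧
        -- the forward straddle relations (S)_{n−1}, (S)_n
        (1 - diagonal (fun p => (bp p : ℂ)) * klPairArray L M β U μ K (n - 1) Qm) * M' = 1 ∧
        (∀ k ∈ klBall L μ K, ∀ k' ∈ klBall L μ K,
          ‖klWickPairArray L M β U μ K (n - 1) Qm k k' - (klPairArray L M β U μ K (n - 1) Qm * M') k k'‖ ≤ R' k k') ∧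
        (∀ x y, R' x y ≤ r') ∧
        (1 - diagonal (fun p => (bs p : ℂ)) * klPairArray L M β U μ K n Qm) * M₀ = 1 ∧
        (∀ k ∈ klBall L μ K, ∀ k' ∈ klBall L μ K,
          ‖klWickPairArray L M β U μ K n Qm k k' - (klPairArray L M β U μ K n Qm * M₀) k k'‖ ≤ ER k k') ∧
        (∀ x y, ER x y ≤ eR) ∧
        -- the intermediate majorants and the smallness conditions
        (∀ x y, Ea x y + (R' x y + 3 / 2 * (3 / 2 * m) * ∑ t, R' x t * |w₁ t| + 3 / 2 * (3 / 2 * m + r') * ∑ a, |w₁ a| * R' a y +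
            9 / 4 * (3 / 2 * m + r') * (3 / 2 * m) * ∑ a, ∑ t, |w₁ a| * R' a t * |w₁ t|) ≤ E₁ x y) ∧
        (∀ x y, E₁ x y ≤ e₁) ∧ (∀ x y, ER x y + E₁ x y ≤ E₂ x y) ∧
        m * ∑ a, |bp a| ≤ 1 / 3 ∧ (3 / 2 * m + r') * ∑ a, |w₁ a| ≤ 1 / 3 ∧ (9 / 4 * m + e₁ + eR) * ∑ a, |bs a| ≤ 1 / 3 ∧
        -- the composite weight's masses and the V10 budget
        (∑ p, |w₁ p + bs p - bp p| ≤ G.bhi) ∧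
        (∑ p, (|w₁ p + bs p - bp p| - (w₁ p + bs p - bp p)) ≤ 2 * klEdge G n (klTorusNorm L Qm)) ∧
        (∀ k ∈ klBall L μ K, ∀ k' ∈ klBall L μ K,
          E₂ k k' + 3 / 2 * (9 / 4 * m) * ∑ t, E₂ k t * |bs t| + 3 / 2 * (9 / 4 * m + e₁ + eR) * ∑ a, |bs a| * E₂ a k' +
              9 / 4 * (9 / 4 * m + e₁ + eR) * (9 / 4 * m) * ∑ a, ∑ t, |bs a| * E₂ a t * |bs t| ≤
            drivePBar G P U (n - 1) + eremBar G P Q U β L (n - 1) + thermalBar G P U β n +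
              legDressBarQ2 G P Q U n (legSliceCountT L β μ K n ![k', Qm - k', Qm - k, k]) +
              (P.Klam * U) ^ 2 * (G.phGain n (klTorusNorm L (k - k')) + G.phGain n (klTorusNorm L (k + k' - Qm))))) :
    PairLadderStepAtV10 L M G P Q β U μ K n := by
  refine pairLadderStepAtV10_of_wickTower_fwd L M hn hm hC₀ fun Qm hQm => ?_
  obtain ⟨M', M₀, bp, w₁, bs, Xs, b', α, αd, γ, γd, W, ρ, R', Ea, ER, E₁, E₂, IX, r', eR, e₁, mW, A, hr', heR, he₁, hmW, hA, hR'0, hEa0,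
    hER0, hXs, hW, hw₁, hb'c, hα, hαdc, hγ, hγdc, hα0, hγ0, hΓm, hαA, hγA, hρ, hsm, hIX, hEa, hM', hR', hR'e, hM₀, hER, hERe, hE₁, hE₁e,
    hE₂, hsm₀, hsm₁, hsm₂, hmass, hneg, hbud⟩ := htower Qm hQm
  obtain ⟨N, hN1, -, -, hstep⟩ := klws_wickArrayStep_of_scaleFlow_dressed L M β U μ K n hZ Qm (Γ Qm) (Γ' Qm) Xs b' α αd γ γd W
    (by subst hΓdef; rfl) (by subst hΓ'def; rfl) hXs hW w₁ hw₁ ρ hmW hA hb'c hα hαdc hγ hγdc hα0 hγ0 hΓm hαA hγA hρ hsm IX hIX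
  exact ⟨klWickPairArray L M β U μ K (n - 1) Qm, klWickPairArray L M β U μ K n Qm, M', N, M₀, bp, w₁, bs, R', Ea, ER, E₁, E₂, r', eR,
    e₁, hr', heR, he₁, klws_wickPairArray_eq_zero_off L M β U μ K (n - 1) Qm, klws_wickPairArray_eq_zero_off L M β U μ K n Qm, hR'0,
    hEa0, hER0, hM', hR', hR'e, hN1, fun k hk k' hk' => (hstep k hk k' hk').trans (hEa k hk k' hk'), hM₀, hER, hERe, hE₁, hE₁e, hE₂,
    hsm₀, hsm₁, hsm₂, hmass, hneg, hbud⟩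

end Model

end Summit.HubbardSuperconductivity.HubbardSuperconductivity.Theorems.KLRegimeWick

end
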